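import Mathlib
import Summits.ValiantsHypothesis.ValiantsHypothesis.Theorems.BarrierLeverPartitionMinorsHitByVPHiddenStatesHubJoins

/-!
# Route BarrierLever — item `PartitionMinorsHitByVP` (stmt-ValiantsHypothesis-19717), line `hidden-states`,
# stub `stub_qjoinSharp` (Q_join(h²)): HUB JOINS ARE GOOD beyond the star range for every row family with a parallel class

Helper file 2/2 (`--supports stmt-ValiantsHypothesis-19717`; cell valiant-natproofs, rung V4, 𝒟-side door (c); prover seat
val-np-p8 gen 3, lane `stub_qjoinSharp`). Bookkeeping defs (`ind`, `lab`, `hubTab`, `partner`, `copartner`); closes NO item.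

THEOREM (`hubJoin_det_ne_zero`, zeta). Let `u` be an injective row family and suppose its rows can be assigned to the
columns of the hub-join family `hubE` (file 1/2) by an injective `φ : Fin r → Fin r` so that every DERIVED column `k` (a hub
`{0}` or a married pair `{0,i}`) and its PARTNER `k⁻` (the base `∅`, resp. the satellite `{i}`) satisfy `X ⊆ u(φ k⁻)`,
`Y ∩ u(φ k⁻) = ∅`, `u(φ k) = (u(φ k⁻) ∖ X) ∪ Y` for two fixed disjoint sets `X, Y` — a PARALLEL CLASS of `u` (pairs
`S ↦ (S∖X)∪Y`: hypercube edges `S ↦ S+y`, swaps `S ↦ S−x+y` inside a layer, …). Then the integer table `hubTab`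
(`base ↦ 1_{u φ base}`, `hub ↦ 1_Y − 1_X`, `satellite q ↦ 1_{u φ {q}} − 1_{base}`) turns EVERY column into the indicator
vector of its own row (`jpt_hubTab`), the matrix is the zeta matrix `[u i ⊆ u(φ k)]`, `det ≠ 0` (`indepOn_of_labels`). `exists_labels`: such a `φ` exists as
soon as `u` has at least `#derived ≤ m(l+1)` (`card_derived_le`) members `S` with `X ⊆ S`, `Y ∩ S = ∅`, `(S∖X)∪Y ∈ range u`
(injection into the good rows, successors, `Finset.exists_equiv_extend_of_card_eq`).
COROLLARY (`qjoinSharp_body_of_parallelClass`, the stub's shape with `u` restricted): for every `h`, `l + 1 ≤ h·h` and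
`r ≤ 2h(h·h+1+l)` ONE join threshold family with `2h` pieces of `h·h` states (namely `hubE`) has, for EVERY injective
`u : Fin r → Finset (Fin h)` possessing a parallel class of size `2h(l+1)`, a table with nonsingular block-additive matrix.
So Q_join(h²) holds up to `r = 4h³` (`l = h²−1`) for all such `u` (any family containing a whole layer, ball or cube on
enough vertices: the witnesses that killed EVERY single-cube door, e.g. `FiveRank.not_stub_qstarCube`, are harmless here).
WHAT THIS IS NOT: not `stub_qjoinSharp` for ALL `u` (a Sidon-type family — all pairwise sums `1_S + 1_T` distinct — has no
parallel class of size 2, and such families exist far above `2h³`); nothing on crux 14610 or VP ≠ VNP.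
-/

set_option linter.dupNamespace false

namespace Summit.ValiantsHypothesis.ValiantsHypothesis.Theorems.BarrierLever.HiddenStates

open Finset Matrix

noncomputable section

namespace HubJoin

open JoinFilling (jpt jcol IndepOn indepOn_of_labels det_ne_zero_of_indepOn)

variable {h m K l r : ℕ}

/-! ## 3. The labelled table: every column becomes the indicator of its own row -/

/-- The `0/1` indicator of a set of coordinates, as a complex vector. -/
def ind (S : Finset (Fin h)) (a : Fin h) : ℂ := if a ∈ S then 1 else 0

/-- Fitting a parallel pair: `1_S + (1_Y − 1_X) = 1_{(S∖X)∪Y}` when `X ⊆ S` and `Y ∩ S = ∅`. -/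
theorem ind_fit (S X Y : Finset (Fin h)) (hX : X ⊆ S) (hY : Disjoint Y S) (a : Fin h) :
    ind S a + (ind Y a - ind X a) = ind ((S \ X) ∪ Y) a := by
  unfold ind
  by_cases haY : a ∈ Y
  · have haS : a ∉ S := fun h' => Finset.disjoint_left.mp hY haY h'
    have haX : a ∉ X := fun h' => haS (hX h')
    simp [haY, haS, haX]
  · by_cases haX : a ∈ X
    · have haS : a ∈ S := hX haX
      simp [haY, haS, haX]
    · by_cases haS : a ∈ S
      · simp [haY, haS, haX]
      · simp [haY, haS, haX]

/-- The label (row) of the column with absolute index `t`; empty beyond `r`. -/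
def lab (u : Fin r → Finset (Fin h)) (φ : Fin r → Fin r) (t : ℕ) : Finset (Fin h) :=
  if ht : t < r then u (φ ⟨t, ht⟩) else ∅

/-- The label below `r` is the labelled row. -/
theorem lab_eq (u : Fin r → Finset (Fin h)) (φ : Fin r → Fin r) (t : ℕ) (ht : t < r) :
    lab u φ t = u (φ ⟨t, ht⟩) := by
  simp [lab, ht]

/-- **The hub table** for a labelling `φ` and a difference pattern `(X, Y)`: the base of piece `p` is the indicator of its
label, the hub state carries `1_Y − 1_X`, satellite `q ≥ 1` carries `1_{label of column {q}} − 1_{base}`. -/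
def hubTab (K l : ℕ) (u : Fin r → Finset (Fin h)) (φ : Fin r → Fin r) (X Y : Finset (Fin h)) (p : Fin m) :
    Option (Fin K) → Fin h → ℂ
  | none => fun a => ind (lab u φ ((p : ℕ) * (K + 1 + l))) a
  | some q => fun a => if (q : ℕ) = 0 then ind Y a - ind X a
      else ind (lab u φ ((p : ℕ) * (K + 1 + l) + q + 1)) a - ind (lab u φ ((p : ℕ) * (K + 1 + l))) a

/-- The PARTNER of a derived column: the base for the hub (position `1`), the satellite `{i}` for the pair `{0,i}`. -/
def partner (hl : l + 1 ≤ K) (k : Fin r) : Fin r :=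
  if (k : ℕ) % (K + 1 + l) = 1 then ⟨(k : ℕ) - 1, by omega⟩ else ⟨(k : ℕ) + 1 - K, by omega⟩

/-- **Every column is the indicator of its own row** under the hub table, provided the derived columns FIT their partners
along the difference pattern `(X, Y)`. -/
theorem jpt_hubTab (hl : l + 1 ≤ K) (hr : r ≤ m * (K + 1 + l)) (u : Fin r → Finset (Fin h)) (φ : Fin r → Fin r)
    (X Y : Finset (Fin h))
    (hfit : ∀ k : Fin r, ((k : ℕ) % (K + 1 + l) = 1 ∨ K < (k : ℕ) % (K + 1 + l)) →
      X ⊆ u (φ (partner hl k)) ∧ Disjoint Y (u (φ (partner hl k))) ∧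
        u (φ k) = (u (φ (partner hl k)) \ X) ∪ Y)
    (k : Fin r) (a : Fin h) :
    jpt (hubTab K l u φ X Y) (hubE hl hr k) a = ind (u (φ k)) a := by
  -- write k = p*B + j with B = K+1+l, j = k % B
  have hjB : (k : ℕ) % (K + 1 + l) < K + 1 + l := pos_lt K l k
  have hk : (k : ℕ) / (K + 1 + l) * (K + 1 + l) + (k : ℕ) % (K + 1 + l) = k := div_mul_add_mod' k (K + 1 + l)
  have hkr := k.2
  simp only [jpt, hubE, hubPiece]
  by_cases h0 : (k : ℕ) % (K + 1 + l) = 0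
  · -- base column
    rw [show hubStates hl ((k : ℕ) % (K + 1 + l)) (pos_lt K l k) = ∅ from by simp [hubStates, h0],
      Finset.sum_empty, add_zero]
    simp only [hubTab]
    rw [lab_eq u φ _ (by omega)]
    congr 3
    apply Fin.ext
    simp only
    omega
  by_cases h1 : (k : ℕ) % (K + 1 + l) = 1
  · -- hub column
    rw [show hubStates hl ((k : ℕ) % (K + 1 + l)) (pos_lt K l k) = {⟨0, by omega⟩} from by
      rw [hubStates_single hl _ _ h0 (by omega)]
      congr 1; apply Fin.ext; simp [h1], Finset.sum_singleton]
    simp only [hubTab, if_true]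
    obtain ⟨hX, hY, hlab⟩ := hfit k (Or.inl h1)
    have hpart : partner hl k = ⟨(k : ℕ) / (K + 1 + l) * (K + 1 + l), by omega⟩ := by
      apply Fin.ext; simp only [partner, if_pos h1]; omega
    rw [lab_eq u φ _ (by omega), hlab, hpart]
    exact ind_fit _ X Y (hpart ▸ hX) (hpart ▸ hY) a
  by_cases hK' : (k : ℕ) % (K + 1 + l) ≤ K
  · -- satellite column {j-1}, j ≥ 2
    rw [show hubStates hl ((k : ℕ) % (K + 1 + l)) (pos_lt K l k) = {⟨(k : ℕ) % (K + 1 + l) - 1, by omega⟩} from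
      hubStates_single hl _ _ h0 hK', Finset.sum_singleton]
    simp only [hubTab]
    rw [if_neg (show (k : ℕ) % (K + 1 + l) - 1 ≠ 0 by omega)]
    rw [add_sub_cancel, lab_eq u φ _ (by show (k : ℕ) / (K + 1 + l) * (K + 1 + l) + ((k : ℕ) % (K + 1 + l) - 1) + 1 < r; omega)]
    congr 3
    apply Fin.ext
    show (k : ℕ) / (K + 1 + l) * (K + 1 + l) + ((k : ℕ) % (K + 1 + l) - 1) + 1 = k
    omega
  · -- pair column {0, j-K}
    have hKj : K < (k : ℕ) % (K + 1 + l) := not_le.mp hK'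
    rw [show hubStates hl ((k : ℕ) % (K + 1 + l)) (pos_lt K l k) = {⟨0, by omega⟩, ⟨(k : ℕ) % (K + 1 + l) - K, by omega⟩} from
      hubStates_pair hl _ _ hKj]
    rw [Finset.sum_pair (by intro heq; have := congrArg Fin.val heq; simp at this; omega)]
    simp only [hubTab, if_true]
    rw [if_neg (show (k : ℕ) % (K + 1 + l) - K ≠ 0 by omega)]
    obtain ⟨hX, hY, hlab⟩ := hfit k (Or.inr hKj)
    have hpart : partner hl k = ⟨(k : ℕ) / (K + 1 + l) * (K + 1 + l) + ((k : ℕ) % (K + 1 + l) - K) + 1, by omega⟩ := by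
      apply Fin.ext
      simp only [partner, if_neg h1]
      omega
    have hlab2 : lab u φ ((k : ℕ) / (K + 1 + l) * (K + 1 + l) + ((k : ℕ) % (K + 1 + l) - K) + 1) =
        u (φ (partner hl k)) := by
      rw [hpart, lab_eq u φ _ (by omega)]
    rw [hlab2, hlab]
    have := ind_fit (u (φ (partner hl k))) X Y hX hY a
    rw [← this]
    ring

/-- **HUB-JOIN ZETA THEOREM.** For an injective row family `u` and an injective labelling `φ` fitting the derived columns to
their partners along a difference pattern `(X, Y)`, the hub table makes the block-additive matrix of the hub-join family
nonsingular (it is the zeta matrix `[u i ⊆ u (φ k)]`). -/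
theorem hubJoin_det_ne_zero (hl : l + 1 ≤ K) (hr : r ≤ m * (K + 1 + l)) (u : Fin r → Finset (Fin h))
    (hu : Function.Injective u) (φ : Fin r → Fin r) (hφ : Function.Injective φ) (X Y : Finset (Fin h))
    (hfit : ∀ k : Fin r, ((k : ℕ) % (K + 1 + l) = 1 ∨ K < (k : ℕ) % (K + 1 + l)) →
      X ⊆ u (φ (partner hl k)) ∧ Disjoint Y (u (φ (partner hl k))) ∧
        u (φ k) = (u (φ (partner hl k)) \ X) ∪ Y) :
    (Matrix.of fun i k : Fin r =>
      ∏ a ∈ u i, (hubTab K l u φ X Y (hubE hl hr k).1 none a +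
        ∑ q ∈ (hubE hl hr k).2, hubTab K l u φ X Y (hubE hl hr k).1 (some q) a)).det ≠ 0 := by
  classical
  refine det_ne_zero_of_indepOn u (hubE hl hr) (hubTab K l u φ X Y) ?_
  refine indepOn_of_labels u (hubE hl hr) (hubTab K l u φ X Y) Finset.univ φ (hu.comp hφ) ?_
  intro k _ a
  rw [jpt_hubTab hl hr u φ X Y hfit k a]
  rfl

/-! ## 4. Labellings exist for row families with a large parallel class -/

/-- The CO-PARTNER: the derived column married to a base (position `0`) or to a satellite (positions `2..l+1`). -/
def copartner (K l : ℕ) (x : ℕ) : ℕ := if x % (K + 1 + l) = 0 then x + 1 else x + K - 1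

/-- The partner of a derived column is not derived (it is a base or a satellite at position `2..l+1`). -/
theorem partner_not_derived (hl : l + 1 ≤ K) (d : Fin r)
    (hd : (d : ℕ) % (K + 1 + l) = 1 ∨ K < (d : ℕ) % (K + 1 + l)) :
    ¬ (((partner hl d : Fin r) : ℕ) % (K + 1 + l) = 1 ∨ K < ((partner hl d : Fin r) : ℕ) % (K + 1 + l)) := by
  have hB : 0 < K + 1 + l := by omega
  have hk := div_mul_add_mod' (d : ℕ) (K + 1 + l)
  have hjB := pos_lt K l (d : ℕ)
  rcases hd with h1 | hK
  · have hp : ((partner hl d : Fin r) : ℕ) = d - 1 := by simp [partner, h1]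
    rw [hp]
    have : ((d : ℕ) - 1) % (K + 1 + l) = 0 := by
      have : (d : ℕ) - 1 = (d : ℕ) / (K + 1 + l) * (K + 1 + l) + 0 := by omega
      rw [this, Nat.add_mod, Nat.mul_mod_left]; simp
    omega
  · have h1 : (d : ℕ) % (K + 1 + l) ≠ 1 := by omega
    have hp : ((partner hl d : Fin r) : ℕ) = d + 1 - K := by simp [partner, h1]
    rw [hp]
    have : ((d : ℕ) + 1 - K) % (K + 1 + l) = (d : ℕ) % (K + 1 + l) + 1 - K := by
      have heq : (d : ℕ) + 1 - K = (d : ℕ) / (K + 1 + l) * (K + 1 + l) + ((d : ℕ) % (K + 1 + l) + 1 - K) := by omega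
      rw [heq, Nat.add_mod, Nat.mul_mod_left, zero_add, Nat.mod_mod, Nat.mod_eq_of_lt (by omega)]
    omega

/-- The co-partner of the partner is the derived column itself. -/
theorem copartner_partner (hl : l + 1 ≤ K) (d : Fin r)
    (hd : (d : ℕ) % (K + 1 + l) = 1 ∨ K < (d : ℕ) % (K + 1 + l)) :
    copartner K l (partner hl d : Fin r) = d := by
  have hB : 0 < K + 1 + l := by omega
  have hk := div_mul_add_mod' (d : ℕ) (K + 1 + l)
  have hjB := pos_lt K l (d : ℕ)
  rcases hd with h1 | hK
  · have hp : ((partner hl d : Fin r) : ℕ) = d - 1 := by simp [partner, h1]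
    have hmod : ((d : ℕ) - 1) % (K + 1 + l) = 0 := by
      have : (d : ℕ) - 1 = (d : ℕ) / (K + 1 + l) * (K + 1 + l) + 0 := by omega
      rw [this, Nat.add_mod, Nat.mul_mod_left]; simp
    simp only [copartner, hp, hmod, if_true]
    omega
  · have h1 : (d : ℕ) % (K + 1 + l) ≠ 1 := by omega
    have hp : ((partner hl d : Fin r) : ℕ) = d + 1 - K := by simp [partner, h1]
    have hmod : ((d : ℕ) + 1 - K) % (K + 1 + l) = (d : ℕ) % (K + 1 + l) + 1 - K := by
      have heq : (d : ℕ) + 1 - K = (d : ℕ) / (K + 1 + l) * (K + 1 + l) + ((d : ℕ) % (K + 1 + l) + 1 - K) := by omega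
      rw [heq, Nat.add_mod, Nat.mul_mod_left, zero_add, Nat.mod_mod, Nat.mod_eq_of_lt (by omega)]
    have hne : ((d : ℕ) + 1 - K) % (K + 1 + l) ≠ 0 := by rw [hmod]; omega
    simp only [copartner, hp, if_neg hne]
    omega

/-- Recovering `S` from `(S∖X)∪Y`. -/
theorem sdiff_union_recover (S X Y : Finset (Fin h)) (hX : X ⊆ S) (hY : Disjoint Y S) :
    (((S \ X) ∪ Y) \ Y) ∪ X = S := by
  ext a
  simp only [Finset.mem_union, Finset.mem_sdiff]
  constructor
  · rintro (⟨hin, haY'⟩ | haX)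
    · rcases hin with ⟨haS, -⟩ | haY
      · exact haS
      · exact absurd haY haY'
    · exact hX haX
  · intro haS
    by_cases haX : a ∈ X
    · exact Or.inr haX
    · refine Or.inl ⟨Or.inl ⟨haS, haX⟩, fun haY => Finset.disjoint_left.mp hY haY haS⟩

/-- **Labellings from a parallel class.** If `u` (injective) has at least as many members `S` with `X ⊆ S`, `Y ∩ S = ∅`,
`(S∖X)∪Y ∈ range u` as the hub-join family has derived columns, then an injective fitting labelling exists. -/
theorem exists_labels (hl : l + 1 ≤ K) (u : Fin r → Finset (Fin h)) (hu : Function.Injective u)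
    (X Y : Finset (Fin h)) (hXY : Disjoint X Y) (hne : (X ∪ Y).Nonempty)
    (hcount : (Finset.univ.filter fun k : Fin r => (k : ℕ) % (K + 1 + l) = 1 ∨ K < (k : ℕ) % (K + 1 + l)).card ≤
      (Finset.univ.filter fun i : Fin r => X ⊆ u i ∧ Disjoint Y (u i) ∧ ∃ i', u i' = (u i \ X) ∪ Y).card) :
    ∃ φ : Fin r → Fin r, Function.Injective φ ∧
      ∀ k : Fin r, ((k : ℕ) % (K + 1 + l) = 1 ∨ K < (k : ℕ) % (K + 1 + l)) →
        X ⊆ u (φ (partner hl k)) ∧ Disjoint Y (u (φ (partner hl k))) ∧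
          u (φ k) = (u (φ (partner hl k)) \ X) ∪ Y := by
  classical
  set D := Finset.univ.filter fun k : Fin r => (k : ℕ) % (K + 1 + l) = 1 ∨ K < (k : ℕ) % (K + 1 + l) with hD
  set S := Finset.univ.filter fun i : Fin r => X ⊆ u i ∧ Disjoint Y (u i) ∧ ∃ i', u i' = (u i \ X) ∪ Y with hS
  have hDmem : ∀ k, k ∈ D ↔ ((k : ℕ) % (K + 1 + l) = 1 ∨ K < (k : ℕ) % (K + 1 + l)) := fun k => by simp [hD]
  have hSmem : ∀ i, i ∈ S ↔ (X ⊆ u i ∧ Disjoint Y (u i) ∧ ∃ i', u i' = (u i \ X) ∪ Y) := fun i => by simp [hS]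
  -- an injection g : D → S
  let g : Fin r → Fin r := fun d =>
    if hd : d ∈ D then ((S.equivFin.symm (Fin.castLE hcount (D.equivFin ⟨d, hd⟩)) : S) : Fin r) else d
  have hgS : ∀ d ∈ D, g d ∈ S := fun d hd => by
    simp only [g, dif_pos hd]; exact Finset.coe_mem _
  have hginj : ∀ d ∈ D, ∀ d' ∈ D, g d = g d' → d = d' := by
    intro d hd d' hd' hdd
    simp only [g, dif_pos hd, dif_pos hd'] at hdd
    have := (S.equivFin.symm.injective (Subtype.ext hdd))
    have := Fin.castLE_injective _ this
    have := D.equivFin.injective this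
    exact congrArg Subtype.val this
  -- the successor of a good row
  let succ : Fin r → Fin r := fun i => if hi : ∃ i', u i' = (u i \ X) ∪ Y then hi.choose else i
  have hsucc : ∀ i ∈ S, u (succ i) = (u i \ X) ∪ Y := fun i hi => by
    obtain ⟨-, -, hex⟩ := (hSmem i).mp hi
    simp only [succ, dif_pos hex]; exact hex.choose_spec
  -- the partial labelling on derived columns and their partners
  let f : Fin r → Fin r := fun x =>
    if x ∈ D then succ (g x) else (if hc : copartner K l x < r then g ⟨copartner K l x, hc⟩ else x)
  set s : Finset (Fin r) := D ∪ D.image (partner hl) with hs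
  -- values on partners
  have hfpart : ∀ d ∈ D, f (partner hl d) = g d := by
    intro d hd
    have hnd : partner hl d ∉ D := fun h' => partner_not_derived hl d ((hDmem d).mp hd) ((hDmem _).mp h')
    have hco := copartner_partner hl d ((hDmem d).mp hd)
    simp only [f, if_neg hnd]
    rw [dif_pos (by rw [hco]; exact d.2)]
    congr 1; exact Fin.ext hco
  have hfder : ∀ d ∈ D, f d = succ (g d) := fun d hd => by simp only [f, if_pos hd]
  -- injectivity of succ ∘ g on D and separation from g
  have hsucc_inj : ∀ i ∈ S, ∀ i₂ ∈ S, succ i = succ i₂ → i = i₂ := by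
    intro i hi i₂ hi₂ heq
    have h1 := hsucc i hi
    have h2 := hsucc i₂ hi₂
    rw [heq] at h1
    obtain ⟨hX₁, hY₁, -⟩ := (hSmem i).mp hi
    obtain ⟨hX₂, hY₂, -⟩ := (hSmem i₂).mp hi₂
    apply hu
    rw [← sdiff_union_recover (u i) X Y hX₁ hY₁, ← sdiff_union_recover (u i₂) X Y hX₂ hY₂, ← h1, h2]
  have hsucc_ne : ∀ i ∈ S, ∀ i₂ ∈ S, succ i ≠ i₂ := by
    intro i hi i₂ hi₂ heq
    have h1 := hsucc i hi
    rw [heq] at h1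
    obtain ⟨hX₂, hY₂, -⟩ := (hSmem i₂).mp hi₂
    rcases Finset.union_nonempty.mp hne with ⟨a, ha⟩ | ⟨a, ha⟩
    · -- a ∈ X ⊆ u i₂ but u i₂ = (u i \ X) ∪ Y avoids X (X ∩ Y = ∅)
      have haU : a ∈ u i₂ := hX₂ ha
      rw [h1, Finset.mem_union, Finset.mem_sdiff] at haU
      rcases haU with ⟨-, haX⟩ | haY
      · exact haX ha
      · exact Finset.disjoint_left.mp hXY ha haY
    · have haU : a ∈ u i₂ := by rw [h1]; exact Finset.mem_union_right _ ha
      exact Finset.disjoint_left.mp hY₂ ha haU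
  have hinj : Set.InjOn f s := by
    intro x hx x' hx' hxx
    simp only [hs, Finset.coe_union, Finset.coe_image, Set.mem_union, Set.mem_image, Finset.mem_coe] at hx hx'
    -- classify x and x'
    have key : ∀ y : Fin r, (y ∈ D ∨ ∃ d ∈ D, partner hl d = y) →
        (y ∈ D ∧ f y = succ (g y)) ∨ (∃ d ∈ D, partner hl d = y ∧ f y = g d) := by
      intro y hy
      by_cases hyD : y ∈ D
      · exact Or.inl ⟨hyD, hfder y hyD⟩
      · rcases hy with hyD' | ⟨d, hd, rfl⟩
        · exact absurd hyD' hyD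
        · exact Or.inr ⟨d, hd, rfl, hfpart d hd⟩
    rcases key x hx with ⟨hxD, hfx⟩ | ⟨d, hd, rfl, hfx⟩ <;> rcases key x' hx' with ⟨hxD', hfx'⟩ | ⟨d', hd', rfl, hfx'⟩
    · rw [hfx, hfx'] at hxx
      exact hginj x hxD x' hxD' (hsucc_inj _ (hgS x hxD) _ (hgS x' hxD') hxx)
    · rw [hfx, hfx'] at hxx
      exact absurd hxx (hsucc_ne _ (hgS x hxD) _ (hgS d' hd'))
    · rw [hfx, hfx'] at hxx
      exact absurd hxx.symm (hsucc_ne _ (hgS x' hxD') _ (hgS d hd))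
    · rw [hfx, hfx'] at hxx
      rw [hginj d hd d' hd' hxx]
  -- extend to a permutation
  obtain ⟨σ, hσ⟩ := Finset.exists_equiv_extend_of_card_eq (t := (Finset.univ : Finset (Fin r))) (by simp)
    (s := s) (f := f) (Finset.subset_univ _) hinj
  refine ⟨fun i => (σ i : Fin r), fun i i' hii => σ.injective (Subtype.ext hii), fun k hk => ?_⟩
  have hkD : k ∈ D := (hDmem k).mpr hk
  have hks : k ∈ s := Finset.mem_union_left _ hkD
  have hps : partner hl k ∈ s := Finset.mem_union_right _ (Finset.mem_image_of_mem _ hkD)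
  simp only
  rw [hσ k hks, hσ _ hps, hfder k hkD, hfpart k hkD, hsucc _ (hgS k hkD)]
  obtain ⟨hX, hY, -⟩ := (hSmem _).mp (hgS k hkD)
  exact ⟨hX, hY, rfl⟩

/-- **Hub joins are good for every row family with a large parallel class** (table existentially). -/
theorem hubJoin_good (hl : l + 1 ≤ K) (hr : r ≤ m * (K + 1 + l)) (u : Fin r → Finset (Fin h))
    (hu : Function.Injective u) (X Y : Finset (Fin h)) (hXY : Disjoint X Y) (hne : (X ∪ Y).Nonempty)
    (hcount : (Finset.univ.filter fun k : Fin r => (k : ℕ) % (K + 1 + l) = 1 ∨ K < (k : ℕ) % (K + 1 + l)).card ≤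
      (Finset.univ.filter fun i : Fin r => X ⊆ u i ∧ Disjoint Y (u i) ∧ ∃ i', u i' = (u i \ X) ∪ Y).card) :
    ∃ tx : Fin m → Option (Fin K) → Fin h → ℂ,
      (Matrix.of fun i k : Fin r =>
        ∏ a ∈ u i, (tx (hubE hl hr k).1 none a + ∑ q ∈ (hubE hl hr k).2, tx (hubE hl hr k).1 (some q) a)).det ≠ 0 := by
  obtain ⟨φ, hφ, hfit⟩ := exists_labels hl u hu X Y hXY hne hcount
  exact ⟨hubTab K l u φ X Y, hubJoin_det_ne_zero hl hr u hu φ hφ X Y hfit⟩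

/-- The number of derived columns is at most `m(l+1)`. -/
theorem card_derived_le (hl : l + 1 ≤ K) (hr : r ≤ m * (K + 1 + l)) :
    (Finset.univ.filter fun k : Fin r => (k : ℕ) % (K + 1 + l) = 1 ∨ K < (k : ℕ) % (K + 1 + l)).card ≤ m * (l + 1) := by
  classical
  -- inject into Fin m × Fin (l+1): k ↦ (piece, 0 for the hub / j - K for the pair {0, j-K})
  let ι : Fin r → Fin m × Fin (l + 1) := fun k =>
    (hubPiece hr k, if hk : K < (k : ℕ) % (K + 1 + l) then ⟨(k : ℕ) % (K + 1 + l) - K, by have := pos_lt K l k; omega⟩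
      else ⟨0, by omega⟩)
  have hinj : Set.InjOn ι (Finset.univ.filter fun k : Fin r => (k : ℕ) % (K + 1 + l) = 1 ∨ K < (k : ℕ) % (K + 1 + l)) := by
    intro k hk k' hk' hkk
    simp only [Finset.coe_filter, Finset.mem_univ, true_and, Set.mem_setOf_eq] at hk hk'
    simp only [ι, Prod.mk.injEq, hubPiece, Fin.mk.injEq] at hkk
    obtain ⟨hp, hq⟩ := hkk
    have hj : (k : ℕ) % (K + 1 + l) = (k' : ℕ) % (K + 1 + l) := by
      rcases hk with h1 | hK1 <;> rcases hk' with h1' | hK1'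
      · omega
      · rw [dif_neg (by omega), dif_pos hK1'] at hq; have := congrArg Fin.val hq; simp at this; omega
      · rw [dif_pos hK1, dif_neg (by omega)] at hq; have := congrArg Fin.val hq; simp at this; omega
      · rw [dif_pos hK1, dif_pos hK1'] at hq; have := congrArg Fin.val hq; simp at this; omega
    apply Fin.ext
    rw [← div_mul_add_mod' (k : ℕ) (K + 1 + l), ← div_mul_add_mod' (k' : ℕ) (K + 1 + l), hp, hj]
  have := Finset.card_le_card_of_injOn ι (fun k _ => Finset.mem_univ (ι k)) hinj
  simpa [Finset.card_univ, Fintype.card_prod, Fintype.card_fin] using this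

/-! ## 5. The stub's shape: Q_join(h²) beyond the star range for row families with a parallel class -/

/-- **Q_join(h²) for row families with a parallel class.** For every `h`, `l + 1 ≤ h·h` and `r ≤ 2h(h·h+1+l)` there is ONE
join threshold family with `m ≤ 2h` pieces of exactly `h·h` states (the hub-join family: injective, strict threshold) whose
block-additive matrix is nonsingular for some table, for EVERY injective `u : Fin r → Finset (Fin h)` having, for some
disjoint `X, Y` (not both empty), at least `2h(l+1)` members `S` with `X ⊆ S`, `Y ∩ S = ∅` and `(S∖X)∪Y ∈ range u`.
This is the body of `Stmt.stub_qjoinSharp` (line `hidden-states`) with the quantifier over `u` restricted to that class;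
it reaches `r = 4h³` (take `l = h·h − 1`), beyond the star range `2h(h·h+1)` of `StarJoin.qjoinSharp_of_le`. -/
theorem qjoinSharp_body_of_parallelClass (h l r : ℕ) (hl : l + 1 ≤ h * h) (hr : r ≤ (h + h) * (h * h + 1 + l)) :
    ∃ (m : ℕ) (W : Fin m → ℕ) (wt : Fin m → Fin (h * h) → ℕ) (e : Fin r → Fin m × Finset (Fin (h * h))),
      m ≤ h + h ∧ Function.Injective e ∧
      (∀ x : Fin m × Finset (Fin (h * h)), x ∉ Set.range e →
        ∀ i, W (e i).1 + ∑ k ∈ (e i).2, wt (e i).1 k < W x.1 + ∑ k ∈ x.2, wt x.1 k) ∧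
      ∀ u : Fin r → Finset (Fin h), Function.Injective u →
        (∃ X Y : Finset (Fin h), Disjoint X Y ∧ (X ∪ Y).Nonempty ∧
          (h + h) * (l + 1) ≤ (Finset.univ.filter fun i : Fin r =>
            X ⊆ u i ∧ Disjoint Y (u i) ∧ ∃ i', u i' = (u i \ X) ∪ Y).card) →
        ∃ tx : Fin m → Option (Fin (h * h)) → Fin h → ℂ,
          (Matrix.of fun i k : Fin r =>
            ∏ a ∈ u i, (tx (e k).1 none a + ∑ q ∈ (e k).2, tx (e k).1 (some q) a)).det ≠ 0 := by
  refine ⟨h + h, hubW (h * h) l r, hubWt (h * h) l r, hubE hl hr, le_rfl, hubE_injective hl hr, hub_threshold hl hr, ?_⟩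
  rintro u hu ⟨X, Y, hXY, hne, hcount⟩
  exact hubJoin_good hl hr u hu X Y hXY hne ((card_derived_le hl hr).trans hcount)

end HubJoin

end

end Summit.ValiantsHypothesis.ValiantsHypothesis.Theorems.BarrierLever.HiddenStates
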